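import Summits.QuantumFields.BalabanUV.T4Continuum.Support.GradedWellTowerAssembly
import Summits.QuantumFields.BalabanUV.T4Continuum.Support.KingLaplacianConsistency

/-!
# T⁴ programme, spine node NE2 (U1a), sub-row Δ1 — THE GRADED WELL: (GW-E) IN THE (H-cons) CURRENCY — the torus transfer needs the
# difference leaf only SANDWICHED BY THE FREE TORUS PROPAGATORS; the split of that leaf into the injected law of `Δ_a` (theorem), the
# vector Laplacian's sandwiched law (theorem, `KingLaplacianConsistency`), the graded-mass law and the GW gauge-sandwich law; the tower END

NE2 formalisation swarm `b2b-balaban-t4-ne2-formalise-*`, LEAF PROVER 06 (gen 8), item «(GW-E) IN (H-cons) CURRENCY» (journal 2026-08-21, this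
seat's LANDED line of p246271), on the owner's O16-f `GradedWellTorusTransfer` (R49) and this seat's `GradedWellTowerAssembly` ((GW-A)).

 * §1 generic resolvent algebra (companion of `RegionGaugeResolventSplit.injected_split`): for `X = Y − E`, `X′ = Y′ − E′`,
   **`injected_split_cons`** `X′⁻¹J − JX⁻¹ = (1 + X′⁻¹E′)·(Y′⁻¹J − JY⁻¹ + Y′⁻¹(E′J − JE)Y⁻¹)·(1 + EX⁻¹)` — the difference term enters
   ONLY through `Y′⁻¹(E′J − JE)Y⁻¹`, i.e. through the (H-cons) field `BackgroundResolventTower.PerturbationLaws.consistent_le` of tiers A/B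
   for the perturbation `P = −E` of the free tower `Y`; norm form **`opNorm_injected_le_split_cons`**.
 * §2 the graded-well instance: **`hinjK_GW_of_torus_cons`** — `hinjK_GW_of_torus` with R49's unsandwiched hypothesis
   `‖E_{k+1}J_k − J_kE_k‖ ≤ Ce·θ^k` REPLACED by the weaker `‖𝒢^{(k+1)}(E_{k+1}J_k − J_kE_k)𝒢^{(k)}‖ ≤ C₂·θ^k`; constant
   `C1Tc = (1 + γ⁻¹e)·(CJ + C₂)·(1 + eγ⁻¹)`.
 * §3 the assembly twins of `GradedWellTowerAssembly` on that hypothesis: `freeTowerLaws_GW_of_torus_cons`,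
   **`towerLimitRate_GW_of_torus_cons`**, `towerLimitRate_GW_perturbed_cons`.
 * §4 THE SPLIT OF THE (H-cons) LEAF.  `E = Δ_a − regionGW` and `regionGW = Σ_ν∇_νᴴ∇_ν + a·M_GW − S_GW` (`GradedWellData.localGW_eq` +
   `regionGW_eq_localGW_sub_sandwich`; `M_GW = Q_GWᴴQ_GW` the graded line mass, `S_GW = B·K⁻¹·Bᴴ` the GW gauge sandwich), so
   **`cons_EGW_eq`**: `𝒢′(E′J − JE)𝒢 = (J𝒢 − 𝒢′J) − 𝒢′(Δ′J − JΔ)𝒢 − a·𝒢′(M′J − JM)𝒢 + 𝒢′(S′J − JS)𝒢` — the torus gauge sandwich and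
   the unit line mass of R49's (E1)/(E3) NEVER APPEAR (they sit inside `Δ_a`, whose two-level law `KingPairingPlantedLaw.injected_le_lev` is
   a theorem); the Laplacian piece is this seat's THEOREM `KingLaplacianConsistency.lapV_consistent_le_lev` (`≤ CLap·L^{−k}`); hence
   **`cons_EGW_le`**: `‖𝒢′(E′J − JE)𝒢‖ ≤ (CJ + CLap)·L^{−k} + a·tM + tS` given the graded-mass law `tM` and the GW-sandwich law `tS`
   (both 𝒢-sandwiched; `opNorm_calDalev_sandwich_le`: an unsandwiched bound costs `Cst²`).
 * §5 THE END OF RECORD of the graded-well tower: **`towerLimitRate_GW_of_laws`** — `TowerLimitRate (k ↦ Qlev (m+k)) L^d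
   (k ↦ (regionGW_{m+k})⁻¹) (Cpert 0 C₀ C₁ 0 0 0) θ` for `L⁻¹ ≤ θ < 1`, MODULO EXACTLY: `hco` (coercivity `γ`, ⟸ (GW-W1)+(GW-S0)),
   `hE` (`‖E_k‖ ≤ e`), `hMc` (the 𝒢-sandwiched graded-mass law, `CM·θ^k` — leaf-03's (E4) object, all graded rows), `hSc` (the 𝒢-sandwiched
   GW gauge-sandwich law, `CS·θ^k` — (GW-B)(GW-K), leaf-05; (GW-Bᵗ) free by `GradedWellTowerAssembly.opNorm_sandwich_comm_le_king`).

HONEST FRAMING (T4-DAG p. 1).  [folklore] bookkeeping over landed modules (model level: `U = 1`, one layer map on unit blocks, `m` fixed,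
finite torus, operator norm) + (1.89) through `KingLaplacianConsistency`; `γ`, `e`, the graded-mass and GW-sandwich laws DISPLAYED; NOT a
statement about Bałaban's multi-region kernels; NE2 (U1a) NOT proved; spine PROVED 0/9 unchanged; NOT [B9] (3.16)/(3.23)–(3.27)/(3.42) as
printed; NOT infinite volume / mass gap / Clay.  HONEST DEPENDENCY: continuum YM on T⁴ ⇐ BetaPertH ∧ nine spine estimates (0/9 proved);
BetaPertH ⇐ (D1) ∧ (D4) ∧ CAP+tail; G-an2-4 gates asym, D1 and NE2/3/4.  No `sorry`.
-/

noncomputable section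

open scoped BigOperators ComplexConjugate Matrix Matrix.Norms.L2Operator

namespace Summit.QuantumFields.BalabanUV.T4Continuum.GradedWellConsistencyTransfer

open Literature.MathematicalPhysics.QuantumFieldTheory.Balaban1983to89.B5Prop11Plancherel (Tor fine Cst Cst_nonneg)
open Literature.MathematicalPhysics.QuantumFieldTheory.Balaban1983to89.B5Action121 (LapV)
open Literature.MathematicalPhysics.QuantumFieldTheory.Balaban1983to89.B5G183RateUnitTower (lev lev_neZero)
open Summit.QuantumFields.BalabanUV.T4Continuum
open Summit.QuantumFields.BalabanUV.T4Continuum.CovariantAveragingTower (TowerLimitRate)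
open Summit.QuantumFields.BalabanUV.T4Continuum.BackgroundResolventTower
open Summit.QuantumFields.BalabanUV.T4Continuum.BalabanAveragedTowerUnit (idx Qlev opNorm_Qlev_sq_le)
open Summit.QuantumFields.BalabanUV.T4Continuum.SubtypeCompression (Coercive isUnit_det_of_coercive opNorm_inv_le_of_coercive)
open Summit.QuantumFields.BalabanUV.T4Continuum.KingPairingPlantedLaw (JK JpcT calDalev CJ CJ_nonneg opNorm_JpcT_le injected_le_lev
  sqrt_smul_Qlev_mul_JpcT isUnit_det_calDalev opNorm_inv_calDalev_le)
open Summit.QuantumFields.BalabanUV.T4Continuum.DirichletRegionTower (gamD gamD_pos coercive_calDalev)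
open Summit.QuantumFields.BalabanUV.T4Continuum.RegionGaugeProjection (gramK)
open Summit.QuantumFields.BalabanUV.T4Continuum.RegionGaugeResolventSplit (gaugeB one_add_mul_inv_eq inv_mul_one_add_eq opNorm_one_add_le)
open Summit.QuantumFields.BalabanUV.T4Continuum.PerturbationAlgebra (perturbationLaws_zero)
open Summit.QuantumFields.BalabanUV.T4Continuum.GradedWellData
open Summit.QuantumFields.BalabanUV.T4Continuum.GradedWellTorusTransfer (EGW regionGW_eq_calDalev_sub)
open Summit.QuantumFields.BalabanUV.T4Continuum.GradedWellTowerAssembly (opNorm_inv_mul_EGW_le complement_le_GW)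
open Summit.QuantumFields.BalabanUV.T4Continuum.KingLaplacianConsistency (CLap CLap_nonneg lapV_consistent_le_lev)

/-! ## §1 Generic: the two-level transfer with the difference term sandwiched by the base propagators -/

section Resolvent

variable {v v' : Type*} [Fintype v] [DecidableEq v] [Fintype v'] [DecidableEq v']

/-- **THE TWO-LEVEL TRANSFER IDENTITY, (H-cons) FORM**: for `X = Y − E`, `X′ = Y′ − E′` (all four invertible) and any planting `J`,
`X′⁻¹J − JX⁻¹ = (1 + X′⁻¹E′)·(Y′⁻¹J − JY⁻¹ + Y′⁻¹(E′J − JE)Y⁻¹)·(1 + EX⁻¹)`. [folklore] -/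
theorem injected_split_cons {X Y E : Matrix v v ℂ} {X' Y' E' : Matrix v' v' ℂ} (hX : IsUnit X.det) (hY : IsUnit Y.det)
    (hE : X = Y - E) (hX' : IsUnit X'.det) (hY' : IsUnit Y'.det) (hE' : X' = Y' - E') (J : Matrix v' v ℂ) :
    X'⁻¹ * J - J * X⁻¹
      = (1 + X'⁻¹ * E') * (Y'⁻¹ * J - J * Y⁻¹ + Y'⁻¹ * (E' * J - J * E) * Y⁻¹) * (1 + E * X⁻¹) := by
  have h1 : (1 + X'⁻¹ * E') * Y'⁻¹ = X'⁻¹ := one_add_mul_inv_eq hX' hY' hE'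
  have h2 : Y⁻¹ * (1 + E * X⁻¹) = X⁻¹ := inv_mul_one_add_eq hX hY hE
  have key : (1 + X'⁻¹ * E') * (Y'⁻¹ * (E' * J - J * E) * Y⁻¹) * (1 + E * X⁻¹) = X'⁻¹ * (E' * J - J * E) * X⁻¹ := by
    calc (1 + X'⁻¹ * E') * (Y'⁻¹ * (E' * J - J * E) * Y⁻¹) * (1 + E * X⁻¹)
        = ((1 + X'⁻¹ * E') * Y'⁻¹) * (E' * J - J * E) * (Y⁻¹ * (1 + E * X⁻¹)) := by simp only [Matrix.mul_assoc]
      _ = X'⁻¹ * (E' * J - J * E) * X⁻¹ := by rw [h1, h2]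
  rw [RegionGaugeResolventSplit.injected_split hX hY hE hX' hY' hE' J, ← key, ← Matrix.add_mul, ← Matrix.mul_add]

/-- **… AND ITS NORM FORM**: `‖X′⁻¹J − JX⁻¹‖ ≤ (1+κ′)·(‖Y′⁻¹J − JY⁻¹‖ + ‖Y′⁻¹(E′J − JE)Y⁻¹‖)·(1+κ)` whenever `‖X′⁻¹E′‖ ≤ κ′`,
`‖EX⁻¹‖ ≤ κ`. [folklore] -/
theorem opNorm_injected_le_split_cons {X Y E : Matrix v v ℂ} {X' Y' E' : Matrix v' v' ℂ} (hX : IsUnit X.det) (hY : IsUnit Y.det)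
    (hE : X = Y - E) (hX' : IsUnit X'.det) (hY' : IsUnit Y'.det) (hE' : X' = Y' - E') (J : Matrix v' v ℂ)
    {κ κ' : ℝ} (hκ : ‖E * X⁻¹‖ ≤ κ) (hκ' : ‖X'⁻¹ * E'‖ ≤ κ') :
    ‖X'⁻¹ * J - J * X⁻¹‖ ≤ (1 + κ') * (‖Y'⁻¹ * J - J * Y⁻¹‖ + ‖Y'⁻¹ * (E' * J - J * E) * Y⁻¹‖) * (1 + κ) := by
  have hκ0 : 0 ≤ 1 + κ' := le_trans (norm_nonneg _) (opNorm_one_add_le hκ')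
  rw [injected_split_cons hX hY hE hX' hY' hE' J]
  calc ‖(1 + X'⁻¹ * E') * (Y'⁻¹ * J - J * Y⁻¹ + Y'⁻¹ * (E' * J - J * E) * Y⁻¹) * (1 + E * X⁻¹)‖
      ≤ ‖(1 + X'⁻¹ * E') * (Y'⁻¹ * J - J * Y⁻¹ + Y'⁻¹ * (E' * J - J * E) * Y⁻¹)‖ * ‖1 + E * X⁻¹‖ := Matrix.l2_opNorm_mul _ _
    _ ≤ ‖1 + X'⁻¹ * E'‖ * ‖Y'⁻¹ * J - J * Y⁻¹ + Y'⁻¹ * (E' * J - J * E) * Y⁻¹‖ * ‖1 + E * X⁻¹‖ :=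
        mul_le_mul_of_nonneg_right (Matrix.l2_opNorm_mul _ _) (norm_nonneg _)
    _ ≤ (1 + κ') * (‖Y'⁻¹ * J - J * Y⁻¹‖ + ‖Y'⁻¹ * (E' * J - J * E) * Y⁻¹‖) * (1 + κ) := by
        gcongr
        · exact opNorm_one_add_le hκ'
        · exact norm_add_le _ _
        · exact opNorm_one_add_le hκ

end Resolvent

/-! ## §2 The graded-well instance: the torus transfer in (H-cons) currency -/

section GW

variable {d : ℕ} (L : ℕ) [NeZero L] (M : Fin d → ℕ) [hM : ∀ μ, NeZero (M μ)] (k m : ℕ) (layer : Tor M → ℕ) (a a' : ℝ) (ha : 0 < a)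

/-- `‖E·G_GW‖ ≤ e·γ⁻¹`. [folklore] -/
theorem opNorm_EGW_mul_inv_le {γ e : ℝ} (hγ : 0 < γ) (he : 0 ≤ e) (hco : Coercive (regionGW L M k m layer a a') γ)
    (hE : ‖EGW L M k m layer a a' ha‖ ≤ e) : ‖EGW L M k m layer a a' ha * (regionGW L M k m layer a a')⁻¹‖ ≤ e * γ⁻¹ :=
  (Matrix.l2_opNorm_mul _ _).trans (mul_le_mul hE (opNorm_inv_le_of_coercive hγ hco) (norm_nonneg _) he)

/-- **THE TORUS TRANSFER, TWO LEVELS, (H-cons) FORM**: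
`‖G_GW′J − JG_GW‖ ≤ (1 + γ⁻¹e)·(‖𝒢′J − J𝒢‖ + ‖𝒢′(E′J − JE)𝒢‖)·(1 + eγ⁻¹)`, `𝒢 = Δ_a⁻¹`. [folklore] -/
theorem opNorm_injected_le_of_torus_cons {γ e : ℝ} (hγ : 0 < γ) (he : 0 ≤ e)
    (hco : Coercive (regionGW L M k m layer a a') γ) (hco' : Coercive (regionGW L M (k + 1) m layer a a') γ)
    (hE : ‖EGW L M k m layer a a' ha‖ ≤ e) (hE' : ‖EGW L M (k + 1) m layer a a' ha‖ ≤ e) :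
    ‖(regionGW L M (k + 1) m layer a a')⁻¹ * JpcT L M k - JpcT L M k * (regionGW L M k m layer a a')⁻¹‖
      ≤ (1 + γ⁻¹ * e) * (‖(calDalev L M a ha (k + 1))⁻¹ * JpcT L M k - JpcT L M k * (calDalev L M a ha k)⁻¹‖
          + ‖(calDalev L M a ha (k + 1))⁻¹ * (EGW L M (k + 1) m layer a a' ha * JpcT L M k - JpcT L M k * EGW L M k m layer a a' ha)
              * (calDalev L M a ha k)⁻¹‖) * (1 + e * γ⁻¹) :=
  opNorm_injected_le_split_cons (isUnit_det_of_coercive hγ hco) (isUnit_det_calDalev L M a ha k)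
    (regionGW_eq_calDalev_sub L M k m layer a a' ha) (isUnit_det_of_coercive hγ hco') (isUnit_det_calDalev L M a ha (k + 1))
    (regionGW_eq_calDalev_sub L M (k + 1) m layer a a' ha) (JpcT L M k) (opNorm_EGW_mul_inv_le L M k m layer a a' ha hγ he hco hE)
    (opNorm_inv_mul_EGW_le L M (k + 1) m layer a a' ha hγ hco' hE')

/-- the two-level constant of the torus transfer in (H-cons) currency. [folklore] -/
def C1Tc (d : ℕ) (a γ e C₂ : ℝ) : ℝ := (1 + γ⁻¹ * e) * (CJ d a + C₂) * (1 + e * γ⁻¹)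

end GW

section GWTower

variable {d : ℕ} (L : ℕ) [NeZero L] (M : Fin d → ℕ) [hM : ∀ μ, NeZero (M μ)] (m : ℕ) (layer : Tor M → ℕ) (a a' : ℝ) (ha : 0 < a)

/-- **`hinjK` FOR THE GRADED WELL FROM THE TORUS LAW AND THE (H-cons) LEAF** (levels `k ≥ m`; `L⁻¹ ≤ θ`; `γ`, `e` level-free):
`‖G_GW(k+1)·J_k − J_k·G_GW(k)‖ ≤ C1Tc·θ^k` from `‖𝒢^{(k+1)}(E_{k+1}J_k − J_kE_k)𝒢^{(k)}‖ ≤ C₂·θ^k`. [folklore] -/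
theorem hinjK_GW_of_torus_cons {γ e θ C₂ : ℝ} (hγ : 0 < γ) (he : 0 ≤ e) (hθ : (L : ℝ)⁻¹ ≤ θ)
    (hco : ∀ k, m ≤ k → Coercive (regionGW L M k m layer a a') γ)
    (hE : ∀ k, m ≤ k → ‖EGW L M k m layer a a' ha‖ ≤ e)
    (hEc : ∀ k, m ≤ k → ‖(calDalev L M a ha (k + 1))⁻¹
        * (EGW L M (k + 1) m layer a a' ha * JpcT L M k - JpcT L M k * EGW L M k m layer a a' ha) * (calDalev L M a ha k)⁻¹‖ ≤ C₂ * θ ^ k)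
    (k : ℕ) (hk : m ≤ k) :
    ‖(regionGW L M (k + 1) m layer a a')⁻¹ * JpcT L M k - JpcT L M k * (regionGW L M k m layer a a')⁻¹‖ ≤ C1Tc d a γ e C₂ * θ ^ k := by
  have hk' : m ≤ k + 1 := Nat.le_succ_of_le hk
  have hL0 : (0 : ℝ) ≤ (L : ℝ)⁻¹ := inv_nonneg.mpr (Nat.cast_nonneg L)
  have hγ0 : 0 ≤ γ⁻¹ := inv_nonneg.mpr hγ.le
  have h := opNorm_injected_le_of_torus_cons L M k m layer a a' ha hγ he (hco k hk) (hco (k + 1) hk') (hE k hk) (hE (k + 1) hk')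
  have hT : ‖(calDalev L M a ha (k + 1))⁻¹ * JpcT L M k - JpcT L M k * (calDalev L M a ha k)⁻¹‖ ≤ CJ d a * θ ^ k :=
    (injected_le_lev L M a ha k).trans (mul_le_mul_of_nonneg_left (pow_le_pow_left₀ hL0 hθ k) (CJ_nonneg d a))
  have h1 : 0 ≤ 1 + γ⁻¹ * e := by have := mul_nonneg hγ0 he; linarith
  have h2 : 0 ≤ 1 + e * γ⁻¹ := by have := mul_nonneg he hγ0; linarith
  refine h.trans ?_
  calc (1 + γ⁻¹ * e) * (‖(calDalev L M a ha (k + 1))⁻¹ * JpcT L M k - JpcT L M k * (calDalev L M a ha k)⁻¹‖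
          + ‖(calDalev L M a ha (k + 1))⁻¹ * (EGW L M (k + 1) m layer a a' ha * JpcT L M k - JpcT L M k * EGW L M k m layer a a' ha)
              * (calDalev L M a ha k)⁻¹‖) * (1 + e * γ⁻¹)
      ≤ (1 + γ⁻¹ * e) * (CJ d a * θ ^ k + C₂ * θ ^ k) * (1 + e * γ⁻¹) := by
        gcongr
        exact hEc k hk
    _ = C1Tc d a γ e C₂ * θ ^ k := by unfold C1Tc; ring

/-! ## §3 The assembly on the (H-cons) leaf -/

/-- **`FreeTowerLaws` FOR THE GRADED-WELL TOWER RE-BASED AT LEVEL `m`, (H-cons) FORM.** [folklore] -/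
theorem freeTowerLaws_GW_of_torus_cons {γ e θ C₂ : ℝ} (hγ : 0 < γ) (he : 0 ≤ e) (hθ : (L : ℝ)⁻¹ ≤ θ)
    (hco : ∀ k, m ≤ k → Coercive (regionGW L M k m layer a a') γ)
    (hE : ∀ k, m ≤ k → ‖EGW L M k m layer a a' ha‖ ≤ e)
    (hEc : ∀ k, m ≤ k → ‖(calDalev L M a ha (k + 1))⁻¹
        * (EGW L M (k + 1) m layer a a' ha * JpcT L M k - JpcT L M k * EGW L M k m layer a a' ha) * (calDalev L M a ha k)⁻¹‖ ≤ C₂ * θ ^ k) :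
    FreeTowerLaws (ι := fun k => idx L M (m + k)) (fun k => regionGW L M (m + k) m layer a a') (fun k => Qlev L M (m + k))
      (fun k => JpcT L M (m + k)) (fun _ => 0) ((L : ℝ) ^ d)
      (fun k => (1 + γ⁻¹ * e) * (2 * d * Cst d a * ((L : ℝ)⁻¹) ^ (m + k))) (fun k => C1Tc d a γ e C₂ * θ ^ (m + k))
      (fun _ => 0) where
  isUnit_det := fun k => isUnit_det_of_coercive hγ (hco (m + k) (Nat.le_add_right m k))
  opNorm_A_sq_le := fun k => opNorm_Qlev_sq_le L M (m + k)
  opNorm_J_le := fun k => opNorm_JpcT_le L M (m + k)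
  A_mul_J := fun k => sqrt_smul_Qlev_mul_JpcT L M (m + k)
  opNorm_F_mul_inv_le := fun k => by rw [Matrix.zero_mul, norm_zero]
  opNorm_inv_mul_F_le := fun k => by rw [Matrix.conjTranspose_zero, Matrix.mul_zero, norm_zero]
  complement_le := fun k =>
    complement_le_GW L M (m + k) m layer a a' ha hγ he (hco (m + k + 1) (Nat.le_add_right_of_le (Nat.le_add_right m k)))
      (hE (m + k + 1) (Nat.le_add_right_of_le (Nat.le_add_right m k)))
  injected_le := fun k => hinjK_GW_of_torus_cons L M m layer a a' ha hγ he hθ hco hE hEc (m + k) (Nat.le_add_right m k)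

/-- **THE GRADED-WELL TOWER CONVERGES, (H-cons) FORM** (`L⁻¹ ≤ θ < 1`): `TowerLimitRate (k ↦ Qlev (m+k)) L^d (k ↦ G_GW(m+k))
(Cpert 0 ((1+γ⁻¹e)·2d·Cst·θ^m) (C1Tc·θ^m) 0 0 0) θ`. [cite: King1986, Lemma 4.5 (4.38) p.674 (shape)] [folklore] -/
theorem towerLimitRate_GW_of_torus_cons {γ e θ C₂ : ℝ} (hγ : 0 < γ) (he : 0 ≤ e) (hθ : (L : ℝ)⁻¹ ≤ θ) (hθ1 : θ < 1)
    (hco : ∀ k, m ≤ k → Coercive (regionGW L M k m layer a a') γ)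
    (hE : ∀ k, m ≤ k → ‖EGW L M k m layer a a' ha‖ ≤ e)
    (hEc : ∀ k, m ≤ k → ‖(calDalev L M a ha (k + 1))⁻¹
        * (EGW L M (k + 1) m layer a a' ha * JpcT L M k - JpcT L M k * EGW L M k m layer a a' ha) * (calDalev L M a ha k)⁻¹‖ ≤ C₂ * θ ^ k) :
    TowerLimitRate (ι := fun k => idx L M (m + k)) (fun k => Qlev L M (m + k)) ((L : ℝ) ^ d)
      (fun k => (regionGW L M (m + k) m layer a a')⁻¹)
      (Cpert 0 ((1 + γ⁻¹ * e) * (2 * d * Cst d a) * θ ^ m) (C1Tc d a γ e C₂ * θ ^ m) 0 0 0) θ := by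
  have hr : (0 : ℝ) < (L : ℝ) ^ d := pow_pos (by exact_mod_cast Nat.pos_of_ne_zero (NeZero.ne L)) d
  have hL0 : (0 : ℝ) ≤ (L : ℝ)⁻¹ := inv_nonneg.mpr (Nat.cast_nonneg L)
  have h1 : 0 ≤ 1 + γ⁻¹ * e := by have := mul_nonneg (inv_nonneg.mpr hγ.le) he; linarith
  have hC₀ : 0 ≤ (1 + γ⁻¹ * e) * (2 * d * Cst d a) := mul_nonneg h1 (by have := Cst_nonneg d a; positivity)
  have ht : ‖(0 : ℂ)‖ * 0 < 1 := by rw [norm_zero, zero_mul]; exact one_pos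
  have h₀ : ∀ k, (1 + γ⁻¹ * e) * (2 * d * Cst d a * ((L : ℝ)⁻¹) ^ (m + k))
      ≤ (1 + γ⁻¹ * e) * (2 * d * Cst d a) * θ ^ m * θ ^ k := fun k => by
    have hp : ((L : ℝ)⁻¹) ^ (m + k) ≤ θ ^ m * θ ^ k := by rw [← pow_add]; exact pow_le_pow_left₀ hL0 hθ (m + k)
    calc (1 + γ⁻¹ * e) * (2 * d * Cst d a * ((L : ℝ)⁻¹) ^ (m + k))
        = (1 + γ⁻¹ * e) * (2 * d * Cst d a) * ((L : ℝ)⁻¹) ^ (m + k) := by ring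
      _ ≤ (1 + γ⁻¹ * e) * (2 * d * Cst d a) * (θ ^ m * θ ^ k) := mul_le_mul_of_nonneg_left hp hC₀
      _ = (1 + γ⁻¹ * e) * (2 * d * Cst d a) * θ ^ m * θ ^ k := by ring
  have h₁ : ∀ k, C1Tc d a γ e C₂ * θ ^ (m + k) ≤ C1Tc d a γ e C₂ * θ ^ m * θ ^ k := fun k => by rw [pow_add, mul_assoc]
  have h := towerLimitRate_perturbed hr (freeTowerLaws_GW_of_torus_cons L M m layer a a' ha hγ he hθ hco hE hEc)
    (perturbationLaws_zero (D := fun k => regionGW L M (m + k) m layer a a') (J := fun k => JpcT L M (m + k))) hθ1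
    h₀ h₁ (fun k => by rw [zero_mul]) (fun k => by rw [zero_mul]) ht
  simp only [zero_smul, add_zero] at h
  exact h

/-- the same for the perturbed graded-well tower `(regionGW + tP)⁻¹` under any `PerturbationLaws` family on the re-based tower and
`‖t‖κ < 1`. [folklore] -/
theorem towerLimitRate_GW_perturbed_cons {γ e θ C₂ : ℝ} (hγ : 0 < γ) (he : 0 ≤ e) (hθ : (L : ℝ)⁻¹ ≤ θ) (hθ1 : θ < 1)
    (hco : ∀ k, m ≤ k → Coercive (regionGW L M k m layer a a') γ)
    (hE : ∀ k, m ≤ k → ‖EGW L M k m layer a a' ha‖ ≤ e)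
    (hEc : ∀ k, m ≤ k → ‖(calDalev L M a ha (k + 1))⁻¹
        * (EGW L M (k + 1) m layer a a' ha * JpcT L M k - JpcT L M k * EGW L M k m layer a a' ha) * (calDalev L M a ha k)⁻¹‖ ≤ C₂ * θ ^ k)
    {P : (k : ℕ) → Matrix (idx L M (m + k)) (idx L M (m + k)) ℂ} {κ C₂' : ℝ}
    (hpert : PerturbationLaws (ι := fun k => idx L M (m + k)) (fun k => regionGW L M (m + k) m layer a a') P
      (fun k => JpcT L M (m + k)) κ (fun k => C₂' * θ ^ k)) {t : ℂ} (ht : ‖t‖ * κ < 1) :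
    TowerLimitRate (ι := fun k => idx L M (m + k)) (fun k => Qlev L M (m + k)) ((L : ℝ) ^ d)
      (fun k => (regionGW L M (m + k) m layer a a' + t • P k)⁻¹)
      (Cpert κ ((1 + γ⁻¹ * e) * (2 * d * Cst d a) * θ ^ m) (C1Tc d a γ e C₂ * θ ^ m) C₂' 0 t) θ := by
  have hr : (0 : ℝ) < (L : ℝ) ^ d := pow_pos (by exact_mod_cast Nat.pos_of_ne_zero (NeZero.ne L)) d
  have hL0 : (0 : ℝ) ≤ (L : ℝ)⁻¹ := inv_nonneg.mpr (Nat.cast_nonneg L)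
  have h1 : 0 ≤ 1 + γ⁻¹ * e := by have := mul_nonneg (inv_nonneg.mpr hγ.le) he; linarith
  have hC₀ : 0 ≤ (1 + γ⁻¹ * e) * (2 * d * Cst d a) := mul_nonneg h1 (by have := Cst_nonneg d a; positivity)
  have h₀ : ∀ k, (1 + γ⁻¹ * e) * (2 * d * Cst d a * ((L : ℝ)⁻¹) ^ (m + k))
      ≤ (1 + γ⁻¹ * e) * (2 * d * Cst d a) * θ ^ m * θ ^ k := fun k => by
    have hp : ((L : ℝ)⁻¹) ^ (m + k) ≤ θ ^ m * θ ^ k := by rw [← pow_add]; exact pow_le_pow_left₀ hL0 hθ (m + k)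
    calc (1 + γ⁻¹ * e) * (2 * d * Cst d a * ((L : ℝ)⁻¹) ^ (m + k))
        = (1 + γ⁻¹ * e) * (2 * d * Cst d a) * ((L : ℝ)⁻¹) ^ (m + k) := by ring
      _ ≤ (1 + γ⁻¹ * e) * (2 * d * Cst d a) * (θ ^ m * θ ^ k) := mul_le_mul_of_nonneg_left hp hC₀
      _ = (1 + γ⁻¹ * e) * (2 * d * Cst d a) * θ ^ m * θ ^ k := by ring
  have h₁ : ∀ k, C1Tc d a γ e C₂ * θ ^ (m + k) ≤ C1Tc d a γ e C₂ * θ ^ m * θ ^ k := fun k => by rw [pow_add, mul_assoc]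
  exact towerLimitRate_perturbed hr (freeTowerLaws_GW_of_torus_cons L M m layer a a' ha hγ he hθ hco hE hEc) hpert hθ1
    h₀ h₁ (fun k => le_rfl) (fun k => by rw [zero_mul]) ht

end GWTower

/-! ## §4 The split of the (H-cons) leaf: injected law + vector Laplacian + graded mass + GW gauge sandwich -/

section Split

variable {d : ℕ} (L : ℕ) [NeZero L] (M : Fin d → ℕ) [hM : ∀ μ, NeZero (M μ)] (k m : ℕ) (layer : Tor M → ℕ) (a a' : ℝ) (ha : 0 < a)

/-- **THE GRADED LINE MASS** `M_GW = Q_GWᴴQ_GW` (all graded rows: the unit line averages on the carrier blocks AND the sub-block line averages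
on the layers, print's `st`-convention). [cite: Balaban1985BackgroundPropagators, (3.16) p.393 (shape)] [folklore] -/
def MGW : Matrix (TorK L M k × Fin d) (TorK L M k × Fin d) ℂ := (QvGW L M k m layer)ᴴ * QvGW L M k m layer

/-- **THE GW GAUGE SANDWICH** `S_GW = B·K⁻¹·Bᴴ`, `B = ∂·G′_GW·Q′_GWᴴ`, `K = Q′_GWG′_GW²Q′_GWᴴ` (the O15 resolvent split's sandwich for the
graded data). [cite: Balaban1985BackgroundPropagators, (3.25)–(3.26) pp.394–395 (shape)] [folklore] -/
def SGW : Matrix (TorK L M k × Fin d) (TorK L M k × Fin d) ℂ :=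
  gaugeB (gradT L M k) (GOmGW L M k m layer a') (QsGW L M k m layer)
    * (gramK (GOmGW L M k m layer a') (QsGW L M k m layer))⁻¹
    * (gaugeB (gradT L M k) (GOmGW L M k m layer a') (QsGW L M k m layer))ᴴ

/-- `regionGW = Σ_ν∇_νᴴ∇_ν + a·M_GW − S_GW`. [folklore] -/
theorem regionGW_eq_lapV_add_mass_sub_sandwich :
    regionGW L M k m layer a a'
      = LapV (fine (lev L k) M) ((lev L k : ℕ) : ℂ) + (a : ℂ) • MGW L M k m layer - SGW L M k m layer a' := by
  rw [regionGW_eq_localGW_sub_sandwich, localGW_eq, MGW, SGW]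

/-- **`E = Δ_a − Σ_ν∇_νᴴ∇_ν − a·M_GW + S_GW`** — the torus gauge sandwich and the unit line mass stay INSIDE `Δ_a`. [folklore] -/
theorem EGW_eq :
    EGW L M k m layer a a' ha
      = calDalev L M a ha k - LapV (fine (lev L k) M) ((lev L k : ℕ) : ℂ) - (a : ℂ) • MGW L M k m layer + SGW L M k m layer a' := by
  unfold EGW
  rw [regionGW_eq_lapV_add_mass_sub_sandwich]
  abel

/-- **THE SPLIT, EXACTLY**: `𝒢′(E′J − JE)𝒢 = (J𝒢 − 𝒢′J) − 𝒢′(Δ′J − JΔ)𝒢 − a·𝒢′(M′J − JM)𝒢 + 𝒢′(S′J − JS)𝒢` (`𝒢 = Δ_a⁻¹`,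
`𝒢′Δ_a′ = 1`, `Δ_a𝒢 = 1`). [folklore] -/
theorem cons_EGW_eq :
    (calDalev L M a ha (k + 1))⁻¹ * (EGW L M (k + 1) m layer a a' ha * JpcT L M k - JpcT L M k * EGW L M k m layer a a' ha)
        * (calDalev L M a ha k)⁻¹
      = (JpcT L M k * (calDalev L M a ha k)⁻¹ - (calDalev L M a ha (k + 1))⁻¹ * JpcT L M k)
        - (calDalev L M a ha (k + 1))⁻¹
            * (LapV (fine (lev L (k + 1)) M) ((lev L (k + 1) : ℕ) : ℂ) * JpcT L M k
                - JpcT L M k * LapV (fine (lev L k) M) ((lev L k : ℕ) : ℂ)) * (calDalev L M a ha k)⁻¹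
        - (a : ℂ) • ((calDalev L M a ha (k + 1))⁻¹ * (MGW L M (k + 1) m layer * JpcT L M k - JpcT L M k * MGW L M k m layer)
            * (calDalev L M a ha k)⁻¹)
        + (calDalev L M a ha (k + 1))⁻¹ * (SGW L M (k + 1) m layer a' * JpcT L M k - JpcT L M k * SGW L M k m layer a')
            * (calDalev L M a ha k)⁻¹ := by
  have hY : (calDalev L M a ha (k + 1))⁻¹ * calDalev L M a ha (k + 1) = 1 :=
    Matrix.nonsing_inv_mul _ (isUnit_det_calDalev L M a ha (k + 1))
  have hY0 : calDalev L M a ha k * (calDalev L M a ha k)⁻¹ = 1 := Matrix.mul_nonsing_inv _ (isUnit_det_calDalev L M a ha k)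
  have hfree : (calDalev L M a ha (k + 1))⁻¹ * (calDalev L M a ha (k + 1) * JpcT L M k - JpcT L M k * calDalev L M a ha k)
      * (calDalev L M a ha k)⁻¹ = JpcT L M k * (calDalev L M a ha k)⁻¹ - (calDalev L M a ha (k + 1))⁻¹ * JpcT L M k := by
    rw [Matrix.mul_sub, Matrix.sub_mul, ← Matrix.mul_assoc, hY, Matrix.one_mul, Matrix.mul_assoc, Matrix.mul_assoc _ _ (calDalev L M a ha k)⁻¹,
      hY0, Matrix.mul_one]
  rw [EGW_eq, EGW_eq, ← hfree]
  simp only [Matrix.sub_mul, Matrix.mul_sub, Matrix.add_mul, Matrix.mul_add, Matrix.smul_mul, Matrix.mul_smul, smul_sub]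
  abel

/-- `‖𝒢′·Z·𝒢‖ ≤ Cst²·‖Z‖` — an UNSANDWICHED two-level bound is enough, at the price `Cst²` ((1.89) order zero). [cite: Balaban1984PropagatorsI,
Prop. 1.1 (1.89) p.33] [folklore] -/
theorem opNorm_calDalev_sandwich_le (Z : Matrix (idx L M (k + 1)) (idx L M k) ℂ) :
    ‖(calDalev L M a ha (k + 1))⁻¹ * Z * (calDalev L M a ha k)⁻¹‖ ≤ Cst d a ^ 2 * ‖Z‖ := by
  have hC := Cst_nonneg d a
  calc ‖(calDalev L M a ha (k + 1))⁻¹ * Z * (calDalev L M a ha k)⁻¹‖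
      ≤ ‖(calDalev L M a ha (k + 1))⁻¹ * Z‖ * ‖(calDalev L M a ha k)⁻¹‖ := Matrix.l2_opNorm_mul _ _
    _ ≤ ‖(calDalev L M a ha (k + 1))⁻¹‖ * ‖Z‖ * ‖(calDalev L M a ha k)⁻¹‖ :=
        mul_le_mul_of_nonneg_right (Matrix.l2_opNorm_mul _ _) (norm_nonneg _)
    _ ≤ Cst d a * ‖Z‖ * Cst d a := by
        gcongr
        · exact opNorm_inv_calDalev_le L M a ha (k + 1)
        · exact opNorm_inv_calDalev_le L M a ha k
    _ = Cst d a ^ 2 * ‖Z‖ := by ring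

/-- **THE (H-cons) LEAF FROM ITS PIECES** (`0 ≤ a`, `1 ≤ d`): given the 𝒢-sandwiched graded-mass law `tM` and GW gauge-sandwich law `tS` at
levels `(k, k+1)`, `‖𝒢′(E′J − JE)𝒢‖ ≤ (CJ + CLap)·L^{−k} + a·tM + tS` — the injected law of `Δ_a` and the Laplacian law being THEOREMS.
[folklore] -/
theorem cons_EGW_le (hd : 1 ≤ d) (ha0 : 0 ≤ a) {tM tS : ℝ}
    (hM : ‖(calDalev L M a ha (k + 1))⁻¹ * (MGW L M (k + 1) m layer * JpcT L M k - JpcT L M k * MGW L M k m layer)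
        * (calDalev L M a ha k)⁻¹‖ ≤ tM)
    (hS : ‖(calDalev L M a ha (k + 1))⁻¹ * (SGW L M (k + 1) m layer a' * JpcT L M k - JpcT L M k * SGW L M k m layer a')
        * (calDalev L M a ha k)⁻¹‖ ≤ tS) :
    ‖(calDalev L M a ha (k + 1))⁻¹ * (EGW L M (k + 1) m layer a a' ha * JpcT L M k - JpcT L M k * EGW L M k m layer a a' ha)
        * (calDalev L M a ha k)⁻¹‖ ≤ (CJ d a + CLap d L a) * ((L : ℝ)⁻¹) ^ k + a * tM + tS := by
  have hinj : ‖JpcT L M k * (calDalev L M a ha k)⁻¹ - (calDalev L M a ha (k + 1))⁻¹ * JpcT L M k‖ ≤ CJ d a * ((L : ℝ)⁻¹) ^ k := by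
    rw [← norm_neg, neg_sub]; exact injected_le_lev L M a ha k
  have hlap := lapV_consistent_le_lev L M a ha hd k
  have hmass : ‖(a : ℂ) • ((calDalev L M a ha (k + 1))⁻¹ * (MGW L M (k + 1) m layer * JpcT L M k - JpcT L M k * MGW L M k m layer)
      * (calDalev L M a ha k)⁻¹)‖ ≤ a * tM := by
    rw [norm_smul, Complex.norm_real, Real.norm_of_nonneg ha0]
    exact mul_le_mul_of_nonneg_left hM ha0
  rw [cons_EGW_eq]
  calc _ ≤ ‖JpcT L M k * (calDalev L M a ha k)⁻¹ - (calDalev L M a ha (k + 1))⁻¹ * JpcT L M k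
            - (calDalev L M a ha (k + 1))⁻¹
                * (LapV (fine (lev L (k + 1)) M) ((lev L (k + 1) : ℕ) : ℂ) * JpcT L M k
                    - JpcT L M k * LapV (fine (lev L k) M) ((lev L k : ℕ) : ℂ)) * (calDalev L M a ha k)⁻¹
            - (a : ℂ) • ((calDalev L M a ha (k + 1))⁻¹ * (MGW L M (k + 1) m layer * JpcT L M k - JpcT L M k * MGW L M k m layer)
                * (calDalev L M a ha k)⁻¹)‖
          + ‖(calDalev L M a ha (k + 1))⁻¹ * (SGW L M (k + 1) m layer a' * JpcT L M k - JpcT L M k * SGW L M k m layer a')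
                * (calDalev L M a ha k)⁻¹‖ := norm_add_le _ _
    _ ≤ (CJ d a * ((L : ℝ)⁻¹) ^ k + CLap d L a * ((L : ℝ)⁻¹) ^ k + a * tM) + tS := by
        refine add_le_add ?_ hS
        refine (norm_sub_le _ _).trans (add_le_add ((norm_sub_le _ _).trans (add_le_add hinj hlap)) hmass)
    _ = (CJ d a + CLap d L a) * ((L : ℝ)⁻¹) ^ k + a * tM + tS := by ring

end Split

/-! ## §5 THE END OF RECORD: the graded-well tower modulo coercivity, `‖E‖ ≤ e`, the graded-mass law and the GW gauge-sandwich law -/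

section End

variable {d : ℕ} (L : ℕ) [NeZero L] (M : Fin d → ℕ) [hM : ∀ μ, NeZero (M μ)] (m : ℕ) (layer : Tor M → ℕ) (a a' : ℝ) (ha : 0 < a)

/-- the consistency constant of the END: `CJ + CLap + a·CM + CS`. [folklore] -/
def C2GW (d L : ℕ) (a CM CS : ℝ) : ℝ := CJ d a + CLap d L a + a * CM + CS

/-- **THE (H-cons) LEAF ALONG THE TOWER from the graded-mass and GW-sandwich laws** (`L⁻¹ ≤ θ`): `‖𝒢′(E′J − JE)𝒢‖ ≤ C2GW·θ^k` for
`k ≥ m`. [folklore] -/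
theorem cons_EGW_tower (hd : 1 ≤ d) {θ CM CS : ℝ} (hθ : (L : ℝ)⁻¹ ≤ θ)
    (hMc : ∀ k, m ≤ k → ‖(calDalev L M a ha (k + 1))⁻¹
        * (MGW L M (k + 1) m layer * JpcT L M k - JpcT L M k * MGW L M k m layer) * (calDalev L M a ha k)⁻¹‖ ≤ CM * θ ^ k)
    (hSc : ∀ k, m ≤ k → ‖(calDalev L M a ha (k + 1))⁻¹
        * (SGW L M (k + 1) m layer a' * JpcT L M k - JpcT L M k * SGW L M k m layer a') * (calDalev L M a ha k)⁻¹‖ ≤ CS * θ ^ k)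
    (k : ℕ) (hk : m ≤ k) :
    ‖(calDalev L M a ha (k + 1))⁻¹ * (EGW L M (k + 1) m layer a a' ha * JpcT L M k - JpcT L M k * EGW L M k m layer a a' ha)
        * (calDalev L M a ha k)⁻¹‖ ≤ C2GW d L a CM CS * θ ^ k := by
  have hL0 : (0 : ℝ) ≤ (L : ℝ)⁻¹ := inv_nonneg.mpr (Nat.cast_nonneg L)
  have hp : ((L : ℝ)⁻¹) ^ k ≤ θ ^ k := pow_le_pow_left₀ hL0 hθ k
  have hc : 0 ≤ CJ d a + CLap d L a := add_nonneg (CJ_nonneg d a) (CLap_nonneg d L a)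
  calc _ ≤ (CJ d a + CLap d L a) * ((L : ℝ)⁻¹) ^ k + a * (CM * θ ^ k) + CS * θ ^ k :=
        cons_EGW_le L M k m layer a a' ha hd ha.le (hMc k hk) (hSc k hk)
    _ ≤ (CJ d a + CLap d L a) * θ ^ k + a * (CM * θ ^ k) + CS * θ ^ k := by
        have := mul_le_mul_of_nonneg_left hp hc; linarith
    _ = C2GW d L a CM CS * θ ^ k := by unfold C2GW; ring

/-- **THE END OF RECORD OF THE GRADED-WELL TOWER** (`L⁻¹ ≤ θ < 1`): the King-averaged images of the graded-well propagators on the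
level-`m` lattice CONVERGE at rate `θ`, MODULO EXACTLY: coercivity `γ` of `regionGW` (⟸ (GW-W1)+(GW-S0)), `‖E_k‖ ≤ e`, the 𝒢-sandwiched
graded-mass law (`CM·θ^k`) and the 𝒢-sandwiched GW gauge-sandwich law (`CS·θ^k`) — the faithful torus operator's law, the complement law,
the vector Laplacian's law and (GW-Bᵗ) being THEOREMS. [cite: King1986, Lemma 4.5 (4.38) p.674 (shape)] [folklore] -/
theorem towerLimitRate_GW_of_laws (hd : 1 ≤ d) {γ e θ CM CS : ℝ} (hγ : 0 < γ) (he : 0 ≤ e) (hθ : (L : ℝ)⁻¹ ≤ θ) (hθ1 : θ < 1)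
    (hco : ∀ k, m ≤ k → Coercive (regionGW L M k m layer a a') γ)
    (hE : ∀ k, m ≤ k → ‖EGW L M k m layer a a' ha‖ ≤ e)
    (hMc : ∀ k, m ≤ k → ‖(calDalev L M a ha (k + 1))⁻¹
        * (MGW L M (k + 1) m layer * JpcT L M k - JpcT L M k * MGW L M k m layer) * (calDalev L M a ha k)⁻¹‖ ≤ CM * θ ^ k)
    (hSc : ∀ k, m ≤ k → ‖(calDalev L M a ha (k + 1))⁻¹
        * (SGW L M (k + 1) m layer a' * JpcT L M k - JpcT L M k * SGW L M k m layer a') * (calDalev L M a ha k)⁻¹‖ ≤ CS * θ ^ k) :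
    TowerLimitRate (ι := fun k => idx L M (m + k)) (fun k => Qlev L M (m + k)) ((L : ℝ) ^ d)
      (fun k => (regionGW L M (m + k) m layer a a')⁻¹)
      (Cpert 0 ((1 + γ⁻¹ * e) * (2 * d * Cst d a) * θ ^ m) (C1Tc d a γ e (C2GW d L a CM CS) * θ ^ m) 0 0 0) θ :=
  towerLimitRate_GW_of_torus_cons L M m layer a a' ha hγ he hθ hθ1 hco hE
    (cons_EGW_tower L M m layer a a' ha hd hθ hMc hSc)

end End

end Summit.QuantumFields.BalabanUV.T4Continuum.GradedWellConsistencyTransfer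

end
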